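/-
Copyright (c) 2026. All rights reserved.
Released under Apache 2.0 license as described in the file LICENSE.
Authors: abc-iut cell, F lane seat abc-iut-f-073 (gen 6; KEY INST59H2), over abc-iut-w5-d064's statements
(`MonoThetaProp13Sub.lean`) and abc-iut-w5-d076 / abc-iut-f-185's closed toy datum (`Prop13ToyModel.lean`); consumed BY NAME.
-/
import Literature.IUT.HodgeArakelov.MonoThetaProp13Sub
import Literature.IUT.HodgeArakelov.Prop13ToyModel
import HarnessLib

/-!
# FACT-LIST row F-2781 `Prop13Sub.Rmk321Natural` ([IUTchII] Prop 1.3 (ii)/(iii), sub-node r3: «the natural isomorphism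
# `μ_Ẑ(M_TM) ⥲ μ_Ẑ(G)` of [AbsTopIII], Remark 3.2.1 is the conventional identification») — INSTANCE FORMS and the gauge reading

S. Mochizuki, *Inter-universal Teichmüller theory II*, §1, Proposition 1.3 (ii) (statement, kurims manuscript p. 26) and the
proof of (iii) (p. 27 l. 5–7: «… coincide with the conventional identification between the cyclotomes involved that arises
from conventional scheme theory»), `paper:url-5036b4059555`, record-only typing under the claim key `Mochizuki2012` (D-0012,
disputed); the cited isomorphism is [AbsTopIII] Remark 3.2.1 (S. Mochizuki, *Topics in Absolute Anabelian Geometry III*,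
[MochizukiAbsTopIII2015]) / [FrdII] Thm. 2.4 (ii).  abc-iut-w5-d064 typed r3 as the schema
`Prop13Sub.Rmk321Natural κ : Prop` — `∀ y, κ.idG (B.corMTM_G y) = κ.idMTM y` — over a bs-Galois datum `B : BsGalData Z` and
a BINDER `κ : ConventionalCyclotomes Z B ν` ("the conventional identification", five cyclotomes identified with one
reference cyclotome `ν`).

PROOF-ONLY companion (no `def`, nothing restated).  Kernel status before this file: universal closure REFUTED
(`Prop13Toy.not_forall_rmk321Natural`: re-gauging `κ.idMTM` alone kills r3), conditional refuter
`not_rmk321Natural_regauge`; the instance at the tautological gauge only inside the conjunction `subnodes_ofBsGal`.  This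
file records:

* `rmk321Natural_ofBsGal` — **INSTANCE FORM, head `Rmk321Natural`, for EVERY bs-Galois datum `B`** at the TAUTOLOGICAL
  gauge `κ := ConventionalCyclotomes.ofBsGal B` (reference cyclotome `μ_N(S)`, identifications the composites through `B`'s
  own arrows).  HONEST LABEL: this is the instance abc-iut-w5-d064's vacuity caveat names — at the tautological gauge r3
  is an unfolding of the printed definition of `(*bs-Gal)`; the CONTENT of r3 lies in pinning `κ` to the scheme-theoretic
  identifications ([AbsTopIII] Rmk 3.2.1 / [FrdII] Thm 2.4 (ii), owner L4), for which the tree has no producer.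
* `rmk321Natural_ofBsGal_toy` — the same with ZERO binders, at the closed toy datum `Prop13Toy.bsGalData`
  (abc-iut-w5-d076 / f-185's `Prop13ToyModel.lean`; junk data, labelled as such there).
* `rmk321Natural_iff_corMTM_G_eq` — **the GAUGE READING of r3** (every `κ`): r3 holds iff the datum's arrow
  `μ_Ẑ(M_TM) ⊗ ℤ/N ⥲ μ_Ẑ(G) ⊗ ℤ/N` IS the transport `κ.idMTM ≫ κ.idG⁻¹` of the two identifications — r3 is exactly the
  statement that `B.corMTM_G` is the `κ`-conventional isomorphism, nothing more.
* `Rmk321Natural.regauge` — r3 is INVARIANT under re-gauging BOTH `κ.idG` and `κ.idMTM` by the same automorphism `φ` of the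
  reference cyclotome (only the RELATIVE gauge matters; contrast `not_rmk321Natural_regauge`, which re-gauges `κ.idMTM`
  alone).

HONEST FRAMING: theorems about OUR typed sub-node over OUR interfaces; an instance form at a tautological/toy gauge is NOT
the printed assertion; nothing here bears on [IUTchIII] Cor. 3.12; no side taken on inter-universal Teichmüller theory or
on any author; typed ≠ proved.
-/

noncomputable section

namespace Literature.IUT.HodgeArakelov

universe u w

open Literature.AnabelianGeometry.EtaleTheta

namespace Prop13Sub

variable {S : ThetaSetting.{u}} {F : TemperedFrobenioidData S} {E : EnvOfFrobenioid F}
  {Z : FrobenioidCyclotomes E} {ν : Type w} [Group ν]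

/-! ## Instance forms at the tautological gauge -/

/-- **F-2781, INSTANCE FORM for every bs-Galois datum `B`, at the TAUTOLOGICAL gauge `κ := ofBsGal B`** (LABELLED:
reference cyclotome `μ_N(S)`, `idG := (Rmk 3.2.1)⁻¹ ≫ corr_muN⁻¹`, `idMTM := corr_muN⁻¹` — so r3 unfolds the printed
definition of `(*bs-Gal)`, [IUTchII] Prop 1.3 (ii) p. 26; an instance form at this gauge is NOT the printed assertion that
the [AbsTopIII] Rmk 3.2.1 isomorphism is the scheme-theoretic one).  Second conjunct of abc-iut-w5-d064's
`subnodes_ofBsGal`, exposed with the row's declaration as conclusion head.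
[claim: Mochizuki2012, status: disputed] (IUTchII §1 Prop 1.3 (ii), kurims p.26; [AbsTopIII] Rmk 3.2.1) -/
theorem rmk321Natural_ofBsGal (B : BsGalData Z) :
    Literature.IUT.HodgeArakelov.Prop13Sub.Rmk321Natural (ConventionalCyclotomes.ofBsGal B) :=
  (subnodes_ofBsGal B).2.1

/-! ## The gauge reading of r3 -/

/-- **F-2781, GAUGE READING** (every `κ`): sub-node r3 holds iff the datum's arrow
`corMTM_G : μ_Ẑ(M_TM) ⊗ ℤ/N ⥲ μ_Ẑ(G) ⊗ ℤ/N` equals the transport `κ.idMTM ≫ κ.idG⁻¹` of the two conventional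
identifications — i.e. r3 says precisely that the [AbsTopIII] Rmk 3.2.1 arrow of the datum IS the `κ`-conventional one.
[claim: Mochizuki2012, status: disputed] (IUTchII §1 Prop 1.3 (ii), kurims p.26; [AbsTopIII] Rmk 3.2.1) -/
theorem rmk321Natural_iff_corMTM_G_eq {B : BsGalData Z} (κ : ConventionalCyclotomes Z B ν) :
    Literature.IUT.HodgeArakelov.Prop13Sub.Rmk321Natural κ ↔ B.corMTM_G = κ.idMTM.trans κ.idG.symm := by
  constructor
  · intro h
    ext y
    rw [MulEquiv.trans_apply, ← h y, MulEquiv.symm_apply_apply]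
  · intro h y
    rw [h, MulEquiv.trans_apply, MulEquiv.apply_symm_apply]

/-- **F-2781, GAUGE COVARIANCE**: r3 is invariant under re-gauging BOTH identifications `κ.idG`, `κ.idMTM` by the same
automorphism `φ` of the reference cyclotome — only the relative gauge of `μ_Ẑ(G)` and `μ_Ẑ(M_TM)` matters (contrast
`Prop13Toy.not_rmk321Natural_regauge`: re-gauging `κ.idMTM` alone by `φ ≠ 1` kills r3).
[claim: Mochizuki2012, status: disputed] (IUTchII §1 Prop 1.3 (ii), kurims p.26; [AbsTopIII] Rmk 3.2.1) -/
theorem Rmk321Natural.regauge {B : BsGalData Z} {κ : ConventionalCyclotomes Z B ν}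
    (h : Literature.IUT.HodgeArakelov.Prop13Sub.Rmk321Natural κ) (φ : ν ≃* ν) :
    Literature.IUT.HodgeArakelov.Prop13Sub.Rmk321Natural
      { κ with idG := κ.idG.trans φ, idMTM := κ.idMTM.trans φ } := by
  intro y
  show φ (κ.idG (B.corMTM_G y)) = φ (κ.idMTM y)
  rw [h y]

end Prop13Sub

/-! ## Zero-binder instance at the closed toy datum -/

namespace Prop13Toy

/-- **F-2781, ZERO-BINDER INSTANCE FORM** at the closed toy datum `Prop13Toy.bsGalData` (junk carrier of
`Prop13ToyModel.lean`, labelled as such there) and the tautological gauge `ofBsGal`: r3 holds.  (Same datum at which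
`not_forall_rmk321Natural` refutes the universal closure by re-gauging `idMTM` alone.)
[claim: Mochizuki2012, status: disputed] (IUTchII §1 Prop 1.3 (ii), kurims p.26; [AbsTopIII] Rmk 3.2.1) -/
theorem rmk321Natural_ofBsGal_toy :
    Literature.IUT.HodgeArakelov.Prop13Sub.Rmk321Natural (Prop13Sub.ConventionalCyclotomes.ofBsGal bsGalData) :=
  Prop13Sub.rmk321Natural_ofBsGal bsGalData

end Prop13Toy

end Literature.IUT.HodgeArakelov
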